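import Literature.Probability.RandomPlanarGeometry.CritPercSLEDimension
import Literature.Probability.RandomPlanarGeometry.SLEScaleInvariance
import Literature.Probability.RandomPlanarGeometry.SLEAdaptedProofs
import Literature.Probability.RandomPlanarGeometry.SLERestrictionMartingale
import Literature.Probability.RandomPlanarGeometry.SLETransienceZeroOne
import Literature.Probability.RandomPlanarGeometry.LocalMartingaleProofs
import Literature.Probability.Process.BlumenthalZeroOne
import Literature.MeasureTheory.Hausdorff.CountableDimensionTest
import HarnessLib

/-!
# Beffara's zero-one law for the dimension of the SLE trace (Lemma 3), proved

The named fact `Literature.Probability.RandomPlanarGeometry.ae_dimH_range_sleTrace`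
(`CritPercSLE.lean`, **crit-perc.S20**; V. Beffara, *The dimension of the SLE curves*,
Ann. Probab. 36 (2008), the Theorem of the Introduction: a.s. `dim_H γ[0, ∞) = 2 ∧ (1 + κ/8)`)
is reduced in `CritPercSLEDimension.lean` (`ae_dimH_range_sleTrace_of_pos_of_zero_one`) to the two
statements of Beffara's §1 — positive probability of `{dim_H γ[0, ∞) = 1 + κ/8}` and the
zero-one law — plus the space-filling phase at `κ = 8`. This file **proves the zero-one law**,
Beffara (2008), Lemma 3 (p. 1425; proof referred to V. Beffara, *Hausdorff dimensions for SLE₆*,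
Ann. Probab. 32 (2004)):

> "Lemma 3 (0–1 law for the trace). For all `d ∈ [0, 2]`, we have `P(dim_H H = d) ∈ {0, 1}`."

for every `d`, under the standing hypothesis of the paper that SLE_κ is generated by a curve
(`HasSLETrace κ`; Rohde–Schramm (2005), Thm. 5.1, the named fact `hasSLETrace_of_ne_eight`, and
`hasSLETrace_eight`): `measure_dimH_range_sleTrace_eq_zero_or_one`, with the a.s.-constancy form
`exists_ae_dimH_range_sleTrace_eq` and the null-set form `ae_dimH_range_sleTrace_eq_or_ae_ne`
consumed by the glue. Consequently (`ae_dimH_range_sleTrace_of_measure_pos`,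
`ae_dimH_range_sleTrace_of_measure_pos'`) **Beffara's theorem for `0 < κ ≤ 8` now rests on the
Rohde–Schramm root facts and the single positive-probability statement** of Beffara (2008), §1
p. 1425 ("this implies that `P(dim_H H = 1 + κ/8) > 0`", from Prop. 1 with the one-point
estimate Prop. 4 / Cor. 5 and the second-moment estimate (3.5) of §3) — the body of the paper,
which is NOT formalised here.

## The proof (Blumenthal's zero-one law and scaling, as in Beffara (2004) and in
Rohde–Schramm's proof of Lemma 7.3)

1. **Measurability.** For `t ≥ 0` and `d`, the event `A_t = {d < dim_H γ[0, t]}`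
   (`dimGtEvent`) is, through the countable rational-ball test of
   `Literature/MeasureTheory/Hausdorff/CountableDimensionTest.lean` (`dimH_image_Icc_le_iff`:
   `dim_H γ[0, t] ≤ d` is a countable condition on the values `γ(q)`, `q ∈ ℚ ∩ [0, t]`, of the
   continuous curve `γ`), the preimage of a measurable set of paths under the trace
   (`dimGtEvent_eq_preimage`), hence null-measurable (`aemeasurable_sleTrace_pi`); and it
   coincides a.s. with the `𝓕_t`-event (`dimGtProxy`, `measurableSet_dimGtProxy_filtration`)
   obtained by replacing `γ(q)` by the tip functional `tipLim q (√κ B) = limₙ f_q(W_q + i/(n+1))`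
   (`Loewner.tipLim`, `= γ(q)` on the event of generation by a curve, `tipLim_eq_trace`;
   `𝓕_q`-measurable because the backward Loewner flow at time `q` only involves `W_s`, `s ≤ q`:
   `Loewner.measurable_tipLim_comp`, from the Bernstein-driver approximation of
   `SLETraceMeasurable.lean` / `SLETransienceZeroOne.lean`).
2. **Scaling.** `P(A_t)` does not depend on `t > 0` (`measure_dimGtEvent_eq`): the trace and
   `s ↦ c γ(s/c²)` have the same law (`identDistrib_sleTrace_scale_of_hasSLETrace`,
   Rohde–Schramm Prop. 2.1 (i)), `(c γ(·/c²))[0, t] = c · γ[0, t/c²]` (`Loewner.image_Icc_scale`)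
   and dilations preserve `dim_H` (`dimH_image_mul_left`).
3. **Blumenthal.** The `A_t` decrease as `t = 1/(n+1) ↓ 0` to an event which for every `s > 0`
   is a.s. equal to an `𝓕_s`-event; by Blumenthal's zero-one law
   (`IsPreBrownianReal.measure_zero_or_one_of_germ`, `BlumenthalZeroOne.lean`) and 2.,
   `P(A_t) ∈ {0, 1}` (`measure_dimGtEvent_zero_or_one`).
4. **The whole trace.** `{d < dim_H γ[0, ∞)} = ⋃ₙ A_{n+1}` (`dim_H` of a countable union is the
   supremum), so `P(d < dim_H γ[0, ∞)) = P(A_1) ∈ {0, 1}`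
   (`measure_setOf_lt_dimH_range_zero_or_one`); with `D := sup {d | P(d < dim_H γ[0, ∞)) = 1} ≤ 2`
   and countably many rational levels, `dim_H γ[0, ∞) = D` a.s. (`exists_ae_dimH_range_sleTrace_eq`),
   whence Lemma 3 for every `d`.

## Mathlib

We USE `dimH_iUnion`, `dimH_mono`, `Real.dimH_univ_eq_finrank`, `ContinuousLinearEquiv.dimH_image`,
`ProbabilityTheory.IdentDistrib.measure_mem_eq`, `MeasureTheory.tendsto_measure_iInter_atTop`,
`Monotone.measure_iUnion`, `Filter.EventuallyEq.countable_iInter`, `mem_ae_iff_prob_eq_one₀`,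
`MeasureTheory.StronglyMeasurable.limUnder`, `ENNReal.lt_iff_exists_rat_btwn`,
`ENNReal.le_of_forall_pos_le_add`. Mathlib has no SLE / Loewner chains.

## References

* V. Beffara, *The dimension of the SLE curves*, Ann. Probab. 36 (2008) 1421–1452,
  doi:10.1214/07-AOP364: Lemma 3 and the last paragraph of §1 (p. 1425).
* V. Beffara, *Hausdorff dimensions for SLE₆*, Ann. Probab. 32 (2004) 2606–2629 (the 0–1 law).
* S. Rohde, O. Schramm, *Basic properties of SLE*, Ann. of Math. 161 (2005): Prop. 2.1 (i)
  (scaling), §3 p. 896 (measurability of `f̂ₛ`), Thm. 5.1, proof of Lemma 7.3 p. 910 (the same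
  Blumenthal argument).
* D. Revuz, M. Yor, *Continuous Martingales and Brownian Motion* (1999), Ch. III Thm. (2.15)
  (Blumenthal's zero-one law).
-/

noncomputable section

open Set Filter Topology MeasureTheory ProbabilityTheory Metric Complex
open UpperHalfPlane (upperHalfPlaneSet isOpen_upperHalfPlaneSet)
open Literature.MeasureTheory.Hausdorff
open scoped NNReal ENNReal

namespace Literature.Probability.RandomPlanarGeometry

/-! ### The tip of the trace as an adapted functional of the driving path -/

namespace Loewner

variable {Ω : Type*} {mΩ : MeasurableSpace Ω} {Wp : Ω → ℝ≥0 → ℝ}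

/-- **The tip functional** `tipLim q U = limₙ tipApprox n q U`: the (measurable version of the)
boundary limit `limₙ f^U_q(U(q) + i/(n+1))` of the inverse Loewner map, which IS the tip `γ(q)`
of the trace when `U` is continuous and its chain is generated by a curve (`tipLim_eq_trace`).
Rohde–Schramm (2005), Thm. 4.1 / §3 p. 896. [cite: RohdeSchramm2005, §3 p. 896 and Thm 5.1] -/
def tipLim (q : ℝ≥0) (U : ℝ≥0 → ℝ) : ℂ :=
  limUnder atTop fun n : ℕ ↦ tipApprox n q U

/-- For a continuous driving function whose chain is generated by a curve, the tip functional is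
the trace: `tipLim q U = trace U q` (`tipApprox_eq` and the tip limit
`IsGeneratedByCurve.tendsto_invFunOn_map_seq`). [cite: RohdeSchramm2005, Thm 5.1] -/
theorem tipLim_eq_trace {U : ℝ≥0 → ℝ} (hU : Continuous U) (hγ : ∃ γ, IsGeneratedByCurve U γ)
    (q : ℝ≥0) : tipLim q U = trace U q := by
  have hgen := isGeneratedByCurve_trace hγ
  have h : Tendsto (fun n : ℕ ↦ tipApprox n q U) atTop (𝓝 (trace U q)) := by
    simp only [tipApprox_eq hU, loewnerInvAt_eq]
    exact hgen.tendsto_invFunOn_map_seq hU q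
  exact h.limUnder_eq

/-- The Bernstein nodes `(W(t k / N))ₖ` of a process whose marginals up to time `t` are
measurable (for the σ-algebra `mΩ`) are `mΩ`-measurable. [folklore] -/
theorem measurable_bernNodes_comp (N : ℕ) (t : ℝ≥0)
    (hm : ∀ s, s ≤ t → Measurable fun ω ↦ Wp ω s) :
    Measurable fun ω ↦ bernNodes N t (Wp ω) := by
  refine measurable_pi_lambda _ fun k ↦ hm _ ?_
  rw [Real.toNNReal_le_iff_le_coe]
  refine mul_le_of_le_one_right t.2 ?_
  have hk : ((k : ℕ) : ℝ) ≤ N := by exact_mod_cast Nat.lt_succ_iff.1 k.2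
  exact div_le_one_of_le₀ hk (Nat.cast_nonneg _)

/-- The approximate tips `tipApprox n t (W ω)` of such a process are `mΩ`-measurable (they only
involve the marginals `W_s`, `s ≤ t`). [folklore] -/
theorem measurable_tipApprox_comp (n : ℕ) (t : ℝ≥0)
    (hm : ∀ s, s ≤ t → Measurable fun ω ↦ Wp ω s) :
    Measurable fun ω ↦ tipApprox n t (Wp ω) :=
  (MeasureTheory.StronglyMeasurable.limUnder (l := atTop) fun N ↦
    ((continuous_loewnerInvAt_bernDriverFun N t (y := (1 : ℝ) / (n + 1)) (by positivity)).measurable.comp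
      (measurable_bernNodes_comp N t hm)).stronglyMeasurable).measurable

/-- **The tip functional is adapted**: `ω ↦ tipLim t (W ω)` is measurable for any σ-algebra for
which the marginals `W_s`, `s ≤ t`, are measurable (Rohde–Schramm (2005), §3 p. 896: "`f̂ₛ` is
measurable with respect to the σ-field generated by `ξ(u)`, `u ∈ [0, s]`").
[cite: RohdeSchramm2005, §3 p. 896] -/
theorem measurable_tipLim_comp (t : ℝ≥0) (hm : ∀ s, s ≤ t → Measurable fun ω ↦ Wp ω s) :
    Measurable fun ω ↦ tipLim t (Wp ω) :=
  (MeasureTheory.StronglyMeasurable.limUnder (l := atTop) fun n ↦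
    (measurable_tipApprox_comp n t hm).stronglyMeasurable).measurable

/-- The family of tips at the rational nodes of `[0, t]`, `q ↦ tipLim (min q⁺ t) (W ω)`, is
measurable for any σ-algebra making the marginals `W_s`, `s ≤ t`, measurable. [folklore] -/
theorem measurable_nodeTips (t : ℝ≥0) (hm : ∀ s, s ≤ t → Measurable fun ω ↦ Wp ω s) :
    Measurable fun ω ↦ fun q : ℚ ↦ tipLim (min (q : ℝ).toNNReal t) (Wp ω) :=
  measurable_pi_lambda _ fun q ↦ measurable_tipLim_comp (min (q : ℝ).toNNReal t) fun s hs ↦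
    hm s (hs.trans (min_le_right _ _))

end Loewner

/-! ### Dilations preserve the Hausdorff dimension -/

/-- `dim_H (c • S) = dim_H S` for `c ≠ 0` (the dilation `z ↦ c z` is a continuous linear
automorphism of `ℂ`; Mathlib `ContinuousLinearEquiv.dimH_image`). [folklore] -/
theorem dimH_image_mul_left {c : ℂ} (hc : c ≠ 0) (S : Set ℂ) :
    dimH ((fun z ↦ c * z) '' S) = dimH S := by
  set e : ℂ ≃L[ℂ] ℂ := (LinearEquiv.smulOfNeZero ℂ ℂ c hc).toContinuousLinearEquiv with he
  have hfun : (fun z ↦ c * z) = ⇑e := by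
    funext z
    rfl
  rw [hfun]
  exact e.dimH_image S

/-! ### The events `d < dim_H γ[0, t]` -/

section Events

variable (κ : ℝ≥0)

/-- The event **`d < dim_H γ[0, t]`** for the SLE_κ trace `γ = sleTrace κ ω`. [folklore] -/
def dimGtEvent (t : ℝ≥0) (d : ℝ≥0∞) : Set (ℝ≥0 → ℝ) :=
  {ω | d < dimH (sleTrace κ ω '' Icc 0 t)}

/-- The paths `f : ℝ≥0 → ℂ` whose node values on `[0, t]` fail the countable test `dimHLeSet d`;
for continuous `f` this is `d < dim_H f[0, t]` (`mem_dimGtPaths_iff`), and it is a measurable set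
of the path space (`measurableSet_dimGtPaths`). [folklore] -/
def Loewner.dimGtPaths (t : ℝ≥0) (d : ℝ≥0∞) : Set (ℝ≥0 → ℂ) :=
  {f | nodeVal f t ∉ (dimHLeSet d : Set (ℚ → ℂ))}

/-- The proxy event: the node tips `q ↦ tipLim (min q⁺ t) (√κ B(ω))` fail the test `dimHLeSet d`.
It is an `𝓕_t`-event (`measurableSet_dimGtProxy_filtration`) and coincides with `dimGtEvent`
whenever the chain of `√κ B(ω)` is generated by a curve (`dimGtEvent_ae_eq_dimGtProxy`).
[folklore] -/
def dimGtProxy (t : ℝ≥0) (d : ℝ≥0∞) : Set (ℝ≥0 → ℝ) :=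
  {ω | (fun q : ℚ ↦ Loewner.tipLim (min (q : ℝ).toNNReal t) (sleDriving κ ω)) ∉
    (dimHLeSet d : Set (ℚ → ℂ))}

variable {κ}

/-- `dimGtPaths t d` is measurable (product σ-algebra on `ℝ≥0 → ℂ`). [folklore] -/
theorem Loewner.measurableSet_dimGtPaths (t : ℝ≥0) (d : ℝ≥0∞) :
    MeasurableSet (Loewner.dimGtPaths t d) :=
  (measurableSet_dimHLeSet d).compl.preimage (measurable_nodeVal t)

/-- For a continuous path, `f ∈ dimGtPaths t d ↔ d < dim_H f[0, t]`. [folklore] -/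
theorem Loewner.mem_dimGtPaths_iff {f : ℝ≥0 → ℂ} (hf : Continuous f) (t : ℝ≥0) (d : ℝ≥0∞) :
    f ∈ Loewner.dimGtPaths t d ↔ d < dimH (f '' Icc 0 t) := by
  rw [Loewner.dimGtPaths, mem_setOf_eq, ← dimH_image_Icc_le_iff hf, not_le]

/-- `dimGtEvent κ t d` is the preimage of `dimGtPaths t d` under the (always continuous) trace.
[folklore] -/
theorem dimGtEvent_eq_preimage (t : ℝ≥0) (d : ℝ≥0∞) :
    dimGtEvent κ t d = (fun ω ↦ sleTrace κ ω) ⁻¹' Loewner.dimGtPaths t d := by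
  ext ω
  exact (Loewner.mem_dimGtPaths_iff (continuous_sleTrace κ ω) t d).symm

/-- If SLE_κ is generated by a curve, `dimGtEvent κ t d` is null-measurable (the trace is an
a.e.-measurable random path, `aemeasurable_sleTrace_pi`). [folklore] -/
theorem nullMeasurableSet_dimGtEvent (hκ : HasSLETrace κ) (t : ℝ≥0) (d : ℝ≥0∞) :
    NullMeasurableSet (dimGtEvent κ t d) Process.preWienerMeasure := by
  rw [dimGtEvent_eq_preimage]
  exact (aemeasurable_sleTrace_pi hκ).nullMeasurableSet_preimage (Loewner.measurableSet_dimGtPaths t d)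

/-- The events `dimGtEvent κ t d` increase with `t`. [folklore] -/
theorem dimGtEvent_mono {s t : ℝ≥0} (hst : s ≤ t) (d : ℝ≥0∞) :
    dimGtEvent κ s d ⊆ dimGtEvent κ t d := fun _ hω ↦
  lt_of_lt_of_le hω (dimH_mono (image_mono (Icc_subset_Icc_right hst)))

/-- **The proxy is an `𝓕_t`-event**: the node tips are `𝓕_t`-measurable
(`Loewner.measurable_nodeTips` with the `𝓕_t`-measurability of `W_s`, `s ≤ t`,
`measurable_sleDriving_of_le`) and `dimHLeSet d` is a measurable set of `ℚ → ℂ`. [folklore] -/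
theorem measurableSet_dimGtProxy_filtration (t : ℝ≥0) (d : ℝ≥0∞) :
    MeasurableSet[brownianFiltration t] (dimGtProxy κ t d) :=
  (Loewner.measurable_nodeTips (mΩ := brownianFiltration t) (Wp := fun ω ↦ sleDriving κ ω) t
    (fun _ hs ↦ measurable_sleDriving_of_le κ hs)) (measurableSet_dimHLeSet d).compl

/-- On the event that the chain of `√κ B(ω)` is generated by a curve (almost sure under
`HasSLETrace κ`), the proxy event IS `d < dim_H γ[0, t]`. [folklore] -/
theorem dimGtEvent_ae_eq_dimGtProxy (hκ : HasSLETrace κ) (t : ℝ≥0) (d : ℝ≥0∞) :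
    dimGtEvent κ t d =ᵐ[Process.preWienerMeasure] dimGtProxy κ t d := by
  rw [eventuallyEq_set]
  filter_upwards [hκ] with ω hω
  have htip : (fun q : ℚ ↦ Loewner.tipLim (min (q : ℝ).toNNReal t) (sleDriving κ ω)) =
      nodeVal (sleTrace κ ω) t :=
    funext fun q ↦ Loewner.tipLim_eq_trace (continuous_sleDriving κ ω) hω _
  simp only [dimGtEvent, dimGtProxy, mem_setOf_eq, htip]
  rw [← dimH_image_Icc_le_iff (continuous_sleTrace κ ω), not_le]

end Events

/-! ### Scale invariance of `P[d < dim_H γ[0, t]]` -/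

section Scale

variable {κ : ℝ≥0}

/-- **Scaling**: `P[d < dim_H γ[0, t]] = P[d < dim_H γ[0, t/c²]]` for `c > 0` — scale
invariance in law of the trace (`identDistrib_sleTrace_scale_of_hasSLETrace`), the identity
`(c γ(·/c²))[0, t] = c · γ[0, t/c²]` (`Loewner.image_Icc_scale`) and invariance of `dim_H` under
dilations. Beffara (2004), proof of the 0–1 law; Rohde–Schramm (2005), Prop. 2.1 (i).
[cite: Beffara2008, Lemma 3] -/
theorem measure_dimGtEvent_eq_rescale (hκ : HasSLETrace κ) {c : ℝ≥0} (hc : c ≠ 0) (t : ℝ≥0)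
    (d : ℝ≥0∞) :
    Process.preWienerMeasure (dimGtEvent κ t d) =
      Process.preWienerMeasure (dimGtEvent κ (t / c ^ 2) d) := by
  have hid := identDistrib_sleTrace_scale_of_hasSLETrace hκ hc
  rw [dimGtEvent_eq_preimage, hid.measure_mem_eq (Loewner.measurableSet_dimGtPaths t d)]
  congr 1
  ext ω
  have hcont : Continuous fun s : ℝ≥0 ↦ (c : ℂ) * sleTrace κ ω (s / c ^ 2) :=
    continuous_const.mul ((continuous_sleTrace κ ω).comp (continuous_id.div_const _))
  rw [mem_preimage, Loewner.mem_dimGtPaths_iff hcont, Loewner.image_Icc_scale hc,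
    dimH_image_mul_left (by exact_mod_cast hc)]
  rfl

/-- **`P[d < dim_H γ[0, t]]` does not depend on `t > 0`.** [cite: Beffara2008, Lemma 3] -/
theorem measure_dimGtEvent_eq (hκ : HasSLETrace κ) {s t : ℝ≥0} (hs : 0 < s) (ht : 0 < t)
    (d : ℝ≥0∞) :
    Process.preWienerMeasure (dimGtEvent κ s d) = Process.preWienerMeasure (dimGtEvent κ t d) := by
  set c : ℝ≥0 := NNReal.sqrt (s / t) with hc
  have hc0 : c ≠ 0 := by
    rw [hc]
    exact (NNReal.sqrt_pos.2 (div_pos hs ht)).ne'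
  have hct : s / c ^ 2 = t := by
    rw [hc, NNReal.sq_sqrt, div_div_cancel₀ hs.ne']
  rw [measure_dimGtEvent_eq_rescale hκ hc0 s, hct]

end Scale

/-! ### Blumenthal: `P[d < dim_H γ[0, t]] ∈ {0, 1}` -/

section ZeroOne

variable {κ : ℝ≥0}

/-- **Zero-one law at fixed time**: for `t > 0`, `P[d < dim_H γ[0, t]] ∈ {0, 1}`. The events
decrease as `t = 1/(n+1) ↓ 0` to an event which, for every `s > 0`, coincides a.s. with an
`𝓕_s`-event (the proxies); Blumenthal's zero-one law
(`IsPreBrownianReal.measure_zero_or_one_of_germ`) and the scale invariance of the probabilities.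
Beffara (2008), Lemma 3, proof in Beffara (2004). [cite: Beffara2008, Lemma 3] -/
theorem measure_dimGtEvent_zero_or_one (hκ : HasSLETrace κ) {t : ℝ≥0} (ht : 0 < t) (d : ℝ≥0∞) :
    Process.preWienerMeasure (dimGtEvent κ t d) = 0 ∨
      Process.preWienerMeasure (dimGtEvent κ t d) = 1 := by
  haveI := isProbabilityMeasure_preWienerMeasure'
  set μ : Measure (ℝ≥0 → ℝ) := Process.preWienerMeasure with hμ
  set tn : ℕ → ℝ≥0 := fun n ↦ 1 / ((n : ℝ≥0) + 1) with htn
  have htn_pos : ∀ n, 0 < tn n := fun n ↦ by rw [htn]; positivity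
  have htn_anti : Antitone tn := by
    intro m n hmn
    simp only [htn]
    exact one_div_le_one_div_of_le (by positivity) (by exact_mod_cast Nat.add_le_add_right hmn 1)
  set A : ℕ → Set (ℝ≥0 → ℝ) := fun n ↦ dimGtEvent κ (tn n) d with hA
  set A' : ℕ → Set (ℝ≥0 → ℝ) := fun n ↦ dimGtProxy κ (tn n) d with hA'
  have hA_anti : Antitone A := fun m n hmn ↦ dimGtEvent_mono (htn_anti hmn) d
  have hA_null : ∀ n, NullMeasurableSet (A n) μ := fun n ↦ nullMeasurableSet_dimGtEvent hκ _ d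
  have hAA' : ∀ n, A n =ᵐ[μ] A' n := fun n ↦ dimGtEvent_ae_eq_dimGtProxy hκ _ d
  have hA'_filt : ∀ n, MeasurableSet[brownianFiltration (tn n)] (A' n) := fun n ↦
    measurableSet_dimGtProxy_filtration (tn n) d
  have hA_eq : ∀ n, μ (A n) = μ (A 0) := fun n ↦
    measure_dimGtEvent_eq hκ (htn_pos n) (htn_pos 0) d
  -- the limit event
  set E : Set (ℝ≥0 → ℝ) := ⋂ n, A n with hE
  have hE01 : μ E = 0 ∨ μ E = 1 := by
    refine isPreBrownianReal_brownian.measure_zero_or_one_of_germ Process.measurable_brownian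
      Process.continuous_brownian (fun ω ↦ by rw [Process.brownian_zero]; rfl) fun s hs ↦ ?_
    obtain ⟨m, hm⟩ := exists_nat_one_div_lt (NNReal.coe_pos.2 hs)
    have hms : tn m ≤ s := by
      rw [← NNReal.coe_le_coe, htn]
      push_cast
      exact hm.le
    refine ⟨⋂ n, A' (n + m), ?_, ?_⟩
    · rw [← brownianFiltration_eq_comap s]
      refine MeasurableSet.iInter fun n ↦ ?_
      have hle : tn (n + m) ≤ s := (htn_anti (Nat.le_add_left m n)).trans hms
      exact brownianFiltration.mono hle _ (hA'_filt (n + m))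
    · rw [hE, ← hA_anti.iInter_nat_add m]
      exact Filter.EventuallyEq.countable_iInter fun n ↦ hAA' (n + m)
  have hE_eq : μ E = μ (A 0) := by
    have h := tendsto_measure_iInter_atTop (μ := μ) hA_null hA_anti ⟨0, measure_ne_top μ _⟩
    have hconst : (⇑μ ∘ A) = fun _ ↦ μ (A 0) := funext hA_eq
    rw [hconst] at h
    exact (tendsto_nhds_unique tendsto_const_nhds h).symm
  have ht_eq : μ (dimGtEvent κ t d) = μ (A 0) := measure_dimGtEvent_eq hκ ht (htn_pos 0) d
  rw [ht_eq, ← hE_eq]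
  exact hE01

/-- The event `d < dim_H γ[0, ∞)` is the increasing union of the events `d < dim_H γ[0, n+1]`
(`dim_H` of a countable union is the supremum). [folklore] -/
theorem setOf_lt_dimH_range_sleTrace_eq_iUnion (κ : ℝ≥0) (d : ℝ≥0∞) :
    {ω | d < dimH (range (sleTrace κ ω))} = ⋃ n : ℕ, dimGtEvent κ ((n : ℝ≥0) + 1) d := by
  ext ω
  have hr : range (sleTrace κ ω) = ⋃ n : ℕ, sleTrace κ ω '' Icc 0 ((n : ℝ≥0) + 1) := by
    apply subset_antisymm
    · rintro _ ⟨s, rfl⟩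
      obtain ⟨n, hn⟩ := exists_nat_ge s
      refine mem_iUnion.2 ⟨n, ⟨s, ⟨zero_le, hn.trans ?_⟩, rfl⟩⟩
      exact le_add_of_nonneg_right zero_le
    · exact iUnion_subset fun n ↦ image_subset_range _ _
  simp only [mem_setOf_eq, hr, dimH_iUnion, lt_iSup_iff, mem_iUnion, dimGtEvent]

/-- `{d < dim_H γ[0, ∞)}` is null-measurable. [folklore] -/
theorem nullMeasurableSet_setOf_lt_dimH_range (hκ : HasSLETrace κ) (d : ℝ≥0∞) :
    NullMeasurableSet {ω | d < dimH (range (sleTrace κ ω))} Process.preWienerMeasure := by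
  rw [setOf_lt_dimH_range_sleTrace_eq_iUnion]
  exact NullMeasurableSet.iUnion fun n ↦ nullMeasurableSet_dimGtEvent hκ _ d

/-- `P[d < dim_H γ[0, ∞)] = P[d < dim_H γ[0, 1]]` (monotone union of events of the same
probability). [cite: Beffara2008, Lemma 3] -/
theorem measure_setOf_lt_dimH_range_eq (hκ : HasSLETrace κ) (d : ℝ≥0∞) :
    Process.preWienerMeasure {ω | d < dimH (range (sleTrace κ ω))} =
      Process.preWienerMeasure (dimGtEvent κ 1 d) := by
  rw [setOf_lt_dimH_range_sleTrace_eq_iUnion]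
  have hmono : Monotone fun n : ℕ ↦ dimGtEvent κ ((n : ℝ≥0) + 1) d := fun m n hmn ↦
    dimGtEvent_mono (by exact_mod_cast Nat.add_le_add_right hmn 1) d
  rw [hmono.measure_iUnion]
  have h : ∀ n : ℕ, Process.preWienerMeasure (dimGtEvent κ ((n : ℝ≥0) + 1) d) =
      Process.preWienerMeasure (dimGtEvent κ 1 d) := fun n ↦
    measure_dimGtEvent_eq hκ (by positivity) one_pos d
  simp only [h, ciSup_const]

/-- **Zero-one law for `d < dim_H γ[0, ∞)`.** [cite: Beffara2008, Lemma 3] -/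
theorem measure_setOf_lt_dimH_range_zero_or_one (hκ : HasSLETrace κ) (d : ℝ≥0∞) :
    Process.preWienerMeasure {ω | d < dimH (range (sleTrace κ ω))} = 0 ∨
      Process.preWienerMeasure {ω | d < dimH (range (sleTrace κ ω))} = 1 := by
  rw [measure_setOf_lt_dimH_range_eq hκ]
  exact measure_dimGtEvent_zero_or_one hκ one_pos d

/-- **The dimension of the SLE trace is almost surely constant**: if SLE_κ is generated by a
curve, there is a deterministic `D` with `dim_H γ[0, ∞) = D` almost surely — `D` is the supremum
of the `d` with `P[d < dim_H γ[0, ∞)] = 1`; below `D` these probabilities are `1`, above `D` they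
are `0` (zero-one law), and countably many rational levels suffice. Beffara (2008), Lemma 3 /
Beffara (2004). [cite: Beffara2008, Lemma 3] -/
theorem exists_ae_dimH_range_sleTrace_eq (hκ : HasSLETrace κ) :
    ∃ D : ℝ≥0∞, ∀ᵐ ω ∂Process.preWienerMeasure, dimH (range (sleTrace κ ω)) = D := by
  haveI := isProbabilityMeasure_preWienerMeasure'
  set μ : Measure (ℝ≥0 → ℝ) := Process.preWienerMeasure with hμ
  set good : Set ℝ≥0∞ := {d | μ {ω | d < dimH (range (sleTrace κ ω))} = 1} with hgood
  set D : ℝ≥0∞ := sSup good with hD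
  -- levels in `good` are `< 2`, so `D ≤ 2 < ⊤`
  have hdim2 : ∀ ω : ℝ≥0 → ℝ, dimH (range (sleTrace κ ω)) ≤ 2 := fun ω ↦ by
    calc dimH (range (sleTrace κ ω)) ≤ dimH (univ : Set ℂ) := dimH_mono (subset_univ _)
      _ = 2 := by rw [Real.dimH_univ_eq_finrank, Complex.finrank_real_complex, Nat.cast_ofNat]
  have hD2 : D ≤ 2 := by
    refine sSup_le fun d hd ↦ le_of_lt ?_
    by_contra hle
    push Not at hle
    have hempty : {ω | d < dimH (range (sleTrace κ ω))} = ∅ :=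
      eq_empty_of_forall_notMem fun ω hω ↦ (not_lt_of_ge ((hdim2 ω).trans hle)) hω
    have h1 : μ {ω | d < dimH (range (sleTrace κ ω))} = 1 := hd
    rw [hempty, measure_empty] at h1
    exact zero_ne_one h1
  have hDtop : D ≠ ⊤ := ne_top_of_le_ne_top ENNReal.ofNat_ne_top hD2
  -- below `D`: almost surely `d < dim`
  have hlow : ∀ d < D, ∀ᵐ ω ∂μ, d < dimH (range (sleTrace κ ω)) := by
    intro d hd
    obtain ⟨d', hd', hdd'⟩ := lt_sSup_iff.1 hd
    have h1 : μ {ω | d < dimH (range (sleTrace κ ω))} = 1 := by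
      apply le_antisymm prob_le_one
      calc (1 : ℝ≥0∞) = μ {ω | d' < dimH (range (sleTrace κ ω))} := hd'.symm
        _ ≤ μ {ω | d < dimH (range (sleTrace κ ω))} := measure_mono fun ω hω ↦ hdd'.trans hω
    exact (mem_ae_iff_prob_eq_one₀ (nullMeasurableSet_setOf_lt_dimH_range hκ d)).2 h1
  -- above `D`: almost surely `dim ≤ d`
  have hup : ∀ d, D < d → ∀ᵐ ω ∂μ, dimH (range (sleTrace κ ω)) ≤ d := by
    intro d hd
    have h0 : μ {ω | d < dimH (range (sleTrace κ ω))} = 0 := by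
      rcases measure_setOf_lt_dimH_range_zero_or_one hκ d with h | h
      · exact h
      · exact absurd (le_sSup (s := good) h) (not_le_of_gt hd)
    have : ∀ᵐ ω ∂μ, ω ∉ {ω | d < dimH (range (sleTrace κ ω))} := measure_eq_zero_iff_ae_notMem.1 h0
    exact this.mono fun ω hω ↦ not_lt.1 hω
  refine ⟨D, ?_⟩
  have hlow' : ∀ᵐ ω ∂μ, ∀ q : ℚ, ((q : ℝ).toNNReal : ℝ≥0∞) < D →
      ((q : ℝ).toNNReal : ℝ≥0∞) < dimH (range (sleTrace κ ω)) := by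
    refine ae_all_iff.2 fun q ↦ ?_
    by_cases hq : ((q : ℝ).toNNReal : ℝ≥0∞) < D
    · exact (hlow _ hq).mono fun ω h _ ↦ h
    · exact Eventually.of_forall fun ω h ↦ absurd h hq
  have hup' : ∀ᵐ ω ∂μ, ∀ n : ℕ, dimH (range (sleTrace κ ω)) ≤ D + ((n : ℝ≥0∞) + 1)⁻¹ := by
    refine ae_all_iff.2 fun n ↦ hup _ ?_
    exact ENNReal.lt_add_right hDtop (ENNReal.inv_ne_zero.2 (by simp))
  filter_upwards [hlow', hup'] with ω hl hu
  apply le_antisymm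
  · refine ENNReal.le_of_forall_pos_le_add fun ε hε _ ↦ ?_
    obtain ⟨n, hn⟩ := ENNReal.exists_inv_nat_lt (a := (ε : ℝ≥0∞)) (by exact_mod_cast hε.ne')
    calc dimH (range (sleTrace κ ω)) ≤ D + ((n : ℝ≥0∞) + 1)⁻¹ := hu n
      _ ≤ D + (n : ℝ≥0∞)⁻¹ := by
        gcongr
        exact le_self_add
      _ ≤ D + ε := by
        gcongr
  · by_contra hlt
    push Not at hlt
    obtain ⟨q, -, hq1, hq2⟩ := ENNReal.lt_iff_exists_rat_btwn.1 hlt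
    exact lt_irrefl _ ((hl q hq2).trans hq1)

/-- **Beffara's Lemma 3 (0–1 law for the trace)**: "For all `d ∈ [0, 2]`, we have
`P(dim_H H = d) ∈ {0, 1}`" (`H = γ([0, ∞))` the range of the SLE_κ trace) — here for every `d`,
under the hypothesis that SLE_κ is generated by a curve (`HasSLETrace κ`; Rohde–Schramm's
Thm. 5.1, the named fact `hasSLETrace_of_ne_eight`, and `hasSLETrace_eight`). Beffara, *The
dimension of the SLE curves*, Ann. Probab. 36 (2008), Lemma 3; proof (Blumenthal's zero-one law
and scaling) from Beffara, Ann. Probab. 32 (2004). [cite: Beffara2008, Lemma 3] -/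
theorem measure_dimH_range_sleTrace_eq_zero_or_one (hκ : HasSLETrace κ) (d : ℝ≥0∞) :
    Process.preWienerMeasure {ω | dimH (range (sleTrace κ ω)) = d} = 0 ∨
      Process.preWienerMeasure {ω | dimH (range (sleTrace κ ω)) = d} = 1 := by
  haveI := isProbabilityMeasure_preWienerMeasure'
  obtain ⟨D, hD⟩ := exists_ae_dimH_range_sleTrace_eq hκ
  by_cases hdD : d = D
  · subst hdD
    right
    apply le_antisymm prob_le_one
    calc (1 : ℝ≥0∞) = Process.preWienerMeasure univ := measure_univ.symm
      _ ≤ Process.preWienerMeasure {ω | dimH (range (sleTrace κ ω)) = d} :=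
          measure_mono_ae (hD.mono fun ω hω _ ↦ hω)
  · left
    have h0 : Process.preWienerMeasure {ω | dimH (range (sleTrace κ ω)) ≠ D} = 0 := ae_iff.1 hD
    exact measure_mono_null (fun ω hω ↦ by
      simp only [mem_setOf_eq] at hω ⊢
      rw [hω]
      exact hdD) h0

/-- **Beffara's Lemma 3 in null-set form** (the hypothesis `h01` of the glue
`ae_dimH_range_sleTrace_of_pos_of_zero_one`): if SLE_κ is generated by a curve then, for every
`d`, almost surely `dim_H γ[0, ∞) = d` or almost surely `dim_H γ[0, ∞) ≠ d`.
[cite: Beffara2008, Lemma 3] -/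
theorem ae_dimH_range_sleTrace_eq_or_ae_ne (hκ : HasSLETrace κ) (d : ℝ≥0∞) :
    (∀ᵐ ω ∂Process.preWienerMeasure, dimH (range (sleTrace κ ω)) = d) ∨
      ∀ᵐ ω ∂Process.preWienerMeasure, dimH (range (sleTrace κ ω)) ≠ d := by
  obtain ⟨D, hD⟩ := exists_ae_dimH_range_sleTrace_eq hκ
  by_cases hdD : D = d
  · exact Or.inl (hdD ▸ hD)
  · refine Or.inr (hD.mono fun ω hω ↦ ?_)
    rw [hω]
    exact hdD

end ZeroOne

/-! ### Beffara's theorem reduced to the positive-probability statement -/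

section CritPerc

/-- **`ae_dimH_range_sleTrace` from positive probability alone.** With Lemma 3 proved
(`ae_dimH_range_sleTrace_eq_or_ae_ne`), Beffara's theorem for `0 < κ ≤ 8` follows from
(i) the Rohde–Schramm theorem (`hasSLETrace_of_ne_eight`, Thm. 5.1: the trace exists, so that
Lemma 3 applies for `κ < 8`), (ii) the space-filling phase at `κ = 8`
(`ae_isSpaceFilling_sleTrace_of_eight_le`, Rohde–Schramm Cor. 7.4 and Update) and (iii) the one
remaining statement of the printed proof, Beffara (2008), §1 p. 1425: "this implies that
`P(dim_H H = 1 + κ/8) > 0`" for `0 < κ < 8` (from Prop. 1 with Prop. 4 / Cor. 5 and the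
second-moment estimate (3.5) of §3). [cite: Beffara2008, Theorem (Introduction), §1 p. 1425 and Lemma 3] -/
theorem ae_dimH_range_sleTrace_of_measure_pos (hne : hasSLETrace_of_ne_eight)
    (hSF : ae_isSpaceFilling_sleTrace_of_eight_le (κ := 8))
    (hpos : ∀ {κ : ℝ≥0}, 0 < κ → κ < 8 →
      0 < Process.preWienerMeasure {ω | dimH (range (sleTrace κ ω)) = 1 + (κ : ℝ≥0∞) / 8})
    {κ : ℝ≥0} : ae_dimH_range_sleTrace (κ := κ) := by
  intro hκ0 hκ8
  rcases hκ8.lt_or_eq with hlt | rfl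
  · exact ae_dimH_range_sleTrace_eq_of_measure_pos (hpos hκ0 hlt)
      (ae_dimH_range_sleTrace_eq_or_ae_ne (hne hlt.ne) _)
  · exact ae_dimH_range_sleTrace_eight_of_isSpaceFilling hSF hκ0 hκ8

/-- The same with the `κ = 8` input traced back to the Rohde–Schramm / Lawler–Schramm–Werner root
facts (`ae_isSpaceFilling_sleTrace_of_eight_le_of_facts`): Beffara's theorem for `0 < κ ≤ 8`
follows from `hasSLETrace_eight` (LSW (2004), Thm. 4.7), `hasSLETrace_of_ne_eight` (RS Thm. 5.1),
`tendsto_norm_sleTrace_atTop` (RS Thm. 7.1), `ae_infDist_sleTrace_eq_zero_of_eight_le`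
(RS Lemma 6.3 / (6.2)) and the positive-probability statement of Beffara (2008), §1 p. 1425.
[cite: Beffara2008, Theorem (Introduction), §1 p. 1425 and Lemma 3] -/
theorem ae_dimH_range_sleTrace_of_measure_pos' (h8 : hasSLETrace_eight)
    (hne : hasSLETrace_of_ne_eight) (htr : tendsto_norm_sleTrace_atTop)
    (hd : ae_infDist_sleTrace_eq_zero_of_eight_le)
    (hpos : ∀ {κ : ℝ≥0}, 0 < κ → κ < 8 →
      0 < Process.preWienerMeasure {ω | dimH (range (sleTrace κ ω)) = 1 + (κ : ℝ≥0∞) / 8})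
    {κ : ℝ≥0} : ae_dimH_range_sleTrace (κ := κ) :=
  ae_dimH_range_sleTrace_of_measure_pos hne
    (ae_isSpaceFilling_sleTrace_of_eight_le_of_facts h8 hne htr hd) hpos

end CritPerc

end Literature.Probability.RandomPlanarGeometry

end
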